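import Mathlib
import Summits.Ventures.PercRepro2.Defs
import Summits.Ventures.PercRepro2.Independence
import Summits.Ventures.PercRepro2.Harris
import Summits.Ventures.PercRepro2.Graph
import Summits.Ventures.PercRepro2.Exploration
import Summits.Ventures.PercRepro2.Events
import Summits.Ventures.PercRepro2.FourFunctions
import Summits.Ventures.PercRepro2.Induced
import Summits.Ventures.PercRepro2.Frontier
import Summits.Ventures.PercRepro2.ObsIndependence
import Summits.Ventures.PercRepro2.BHK
import Summits.Ventures.PercRepro2.BHKEvents
import Summits.Ventures.PercRepro2.SideAgreement
import Summits.Ventures.PercRepro2.VdBKahn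
import Summits.Ventures.PercRepro2.BHKAvoid
import Summits.Ventures.PercRepro2.R2PrimeThreeReduction
import Summits.Ventures.PercRepro2.YBridge
import Summits.Ventures.PercRepro2.Yu1Functionals
import Summits.Ventures.PercRepro2.Yu1Events
import Summits.Ventures.PercRepro2.Yu1
import Summits.Ventures.PercRepro2.LBSplit
import Summits.Ventures.PercRepro2.YDelta
import Summits.Ventures.PercRepro2.SD
import Summits.Ventures.PercRepro2.Threshold
import Summits.Ventures.PercRepro2.Lambda
import Summits.Ventures.PercRepro2.LambdaTau
import Summits.Ventures.PercRepro2.LambdaSlack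
import Summits.Ventures.PercRepro2.HF2
import Summits.Ventures.PercRepro2.Yu2
import Summits.Ventures.PercRepro2.N0
import Summits.Ventures.PercRepro2.Y
import Summits.Ventures.PercRepro2.YDeltaTools
import Summits.Ventures.PercRepro2.ZDelta
import Summits.Ventures.PercRepro2.ZExpand
import Summits.Ventures.PercRepro2.ISplit
import Summits.Ventures.PercRepro2.MRl
import Summits.Ventures.PercRepro2.ZOloc
import Summits.Ventures.PercRepro2.SideBridge
import Summits.Ventures.PercRepro2.HCov

/-!
# Two exact zeros of the five-point functional: (A3-O) and (ONE-ROOT)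
(blind cell PercRepro2, typer-1 g8; lead LEAD-SEP3.md §1′, §2, items (81)/(81′))

Both are identities in the 30 masses of `CovForm.Gc` (`HCov.lean`): under the hypothesis the
masses collapse and `Gc = 0` by `ring`, so (HCOV) holds with equality on these classes.

* **(A3-O)** `Gc_eq_zero_of_a3_sep`: if on `Q = {a₁ ↮ a₂}` the mark `o` reaches a root only
  through `a₃` — `{o ∈ C_i} = {o ↔ a₃} ∩ {a₃ ∈ C_i}` on `Q`, for `i = 1, 2` (the event identities of
  LEAD-SEP3 §1′; they hold whenever every path from `o` to a root passes through `a₃`, e.g. `o` in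
  a component of `G − a₃` without roots) — then `D_o = 0`, `P(PD, o ∈ U, b ∈ U) = 0`,
  `E_Q[σ₃ 1_{o∈U}] = E_Q[σ_o]` and `E_Q[σ_b σ₃ 1_{o∈U}] = E_Q[σ_b σ_o]`, hence `Gc = 0`.
* **(ONE-ROOT)** `Gc_eq_zero_of_root_sep`: if on `Q` the cluster of `a₁` contains none of
  `o, b, a₃` (e.g. `a₂` separates `a₁` from `{o, b, a₃}`; `a₁` a leaf at `a₂`) then every `L`-mass
  vanishes, `Q = PD ⊔ T` and `gap = P(Q, b ∈ C₂)` (`gap_eq_Q`), and `Gc = 0`.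

The o ↔ b mirror of (A3-O) is false (LEAD-SEP3 §1′), and no independence is used anywhere.
-/

namespace Summit.Ventures.PercRepro2.SepZero

open CovForm UnionCluster

section Events

variable {V : Type*} {E : Type*} {ends : E → Sym2 V}

/-- `Q = {a₁ ↮ a₂}`, oriented. -/
lemma mem_Q {a₁ a₂ : V} {ω : Config E} :
    ω ∈ avoidAll ends a₂ {a₁} ↔ ¬ Conn ends ω a₁ a₂ := by
  simp only [mem_avoidAll, Finset.mem_singleton, forall_eq]
  exact ⟨fun h hc => h (conn_symm hc), fun h hc => h (conn_symm hc)⟩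

/-- `PD = {a₁ ↮ a₂, a₁ ↮ a₃, a₂ ↮ a₃}`. -/
lemma mem_PD {a₁ a₂ a₃ : V} {ω : Config E} :
    ω ∈ PDEvent ends a₁ a₂ a₃ ↔
      ¬ Conn ends ω a₁ a₂ ∧ ¬ Conn ends ω a₁ a₃ ∧ ¬ Conn ends ω a₂ a₃ := by
  simp only [PDEvent, Dtilde, inU, Set.mem_inter_iff, Set.mem_compl_iff, Set.mem_union,
    connEvent, Set.mem_setOf_eq, not_or]
  constructor
  · rintro ⟨h12, h31, h32⟩
    exact ⟨h12, fun h => h31 (conn_symm h), fun h => h32 (conn_symm h)⟩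
  · rintro ⟨h12, h13, h23⟩
    exact ⟨h12, fun h => h13 (conn_symm h), fun h => h23 (conn_symm h)⟩

/-- `T = {a₁ ↮ a₂, a₂ ↔ a₃}`. -/
lemma mem_T {a₁ a₂ a₃ : V} {ω : Config E} :
    ω ∈ TEvent ends a₁ a₂ a₃ ↔ ¬ Conn ends ω a₁ a₂ ∧ Conn ends ω a₂ a₃ := by
  simp only [TEvent, Set.mem_inter_iff, Set.mem_compl_iff, connEvent, Set.mem_setOf_eq]
  exact ⟨fun ⟨h, h'⟩ => ⟨fun hc => h (conn_symm hc), h'⟩,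
    fun ⟨h, h'⟩ => ⟨fun hc => h (conn_symm hc), h'⟩⟩

/-- `T′ = {a₁ ↮ a₂, a₁ ↔ a₃}`. -/
lemma mem_T' {a₁ a₂ a₃ : V} {ω : Config E} :
    ω ∈ TEvent ends a₂ a₁ a₃ ↔ ¬ Conn ends ω a₁ a₂ ∧ Conn ends ω a₁ a₃ := by
  simp only [TEvent, Set.mem_inter_iff, Set.mem_compl_iff, connEvent, Set.mem_setOf_eq]

/-- On `Q`, `a₃` is not in both clusters. -/
lemma not_conn_both {a₁ a₂ a₃ : V} {ω : Config E} (h : ¬ Conn ends ω a₁ a₂)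
    (h1 : Conn ends ω a₁ a₃) (h2 : Conn ends ω a₂ a₃) : False :=
  h (conn_trans h1 (conn_symm h2))

end Events

section A3O

variable {V : Type*} {E : Type*} [Fintype E] [DecidableEq E] [DecidableEq V]
  {R : Type*} [Field R] [LinearOrder R]

omit [DecidableEq V] [LinearOrder R] in
/-- **(A3-O)**, LEAD-SEP3 §1′: if on `Q` the mark `o` reaches a root only through `a₃`, then
`Gc = 0`. -/
theorem Gc_eq_zero_of_a3_sep (p : E → R) (ends : E → Sym2 V) (o a₁ a₂ a₃ b : V)
    (h₁ : ∀ ω : Config E, ¬ Conn ends ω a₁ a₂ →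
      (Conn ends ω a₁ o ↔ Conn ends ω o a₃ ∧ Conn ends ω a₁ a₃))
    (h₂ : ∀ ω : Config E, ¬ Conn ends ω a₁ a₂ →
      (Conn ends ω a₂ o ↔ Conn ends ω o a₃ ∧ Conn ends ω a₂ a₃)) :
    Gc p ends o a₁ a₂ a₃ b = 0 := by
  -- the six basic event identities
  have d1 : PDEvent ends a₁ a₂ a₃ ∩ connEvent ends a₁ o = ∅ := by
    ext ω
    rw [Set.mem_inter_iff, mem_PD]
    simp only [connEvent, Set.mem_setOf_eq, Set.mem_empty_iff_false, iff_false, not_and]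
    exact fun ⟨h12, h13, _⟩ ho => h13 ((h₁ ω h12).1 ho).2
  have d2 : PDEvent ends a₁ a₂ a₃ ∩ connEvent ends a₂ o = ∅ := by
    ext ω
    rw [Set.mem_inter_iff, mem_PD]
    simp only [connEvent, Set.mem_setOf_eq, Set.mem_empty_iff_false, iff_false, not_and]
    exact fun ⟨h12, _, h23⟩ ho => h23 ((h₂ ω h12).1 ho).2
  have t1 : TEvent ends a₂ a₁ a₃ ∩ connEvent ends a₁ o =
      avoidAll ends a₂ {a₁} ∩ connEvent ends a₁ o := by
    ext ω
    rw [Set.mem_inter_iff, Set.mem_inter_iff, mem_T', mem_Q]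
    simp only [connEvent, Set.mem_setOf_eq]
    exact ⟨fun ⟨⟨h12, _⟩, ho⟩ => ⟨h12, ho⟩, fun ⟨h12, ho⟩ => ⟨⟨h12, ((h₁ ω h12).1 ho).2⟩, ho⟩⟩
  have t2 : TEvent ends a₂ a₁ a₃ ∩ connEvent ends a₂ o = ∅ := by
    ext ω
    rw [Set.mem_inter_iff, mem_T']
    simp only [connEvent, Set.mem_setOf_eq, Set.mem_empty_iff_false, iff_false, not_and]
    exact fun ⟨h12, h13⟩ ho => not_conn_both h12 h13 ((h₂ ω h12).1 ho).2
  have t3 : TEvent ends a₁ a₂ a₃ ∩ connEvent ends a₁ o = ∅ := by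
    ext ω
    rw [Set.mem_inter_iff, mem_T]
    simp only [connEvent, Set.mem_setOf_eq, Set.mem_empty_iff_false, iff_false, not_and]
    exact fun ⟨h12, h23⟩ ho => not_conn_both h12 ((h₁ ω h12).1 ho).2 h23
  have t4 : TEvent ends a₁ a₂ a₃ ∩ connEvent ends a₂ o =
      avoidAll ends a₂ {a₁} ∩ connEvent ends a₂ o := by
    ext ω
    rw [Set.mem_inter_iff, Set.mem_inter_iff, mem_T, mem_Q]
    simp only [connEvent, Set.mem_setOf_eq]
    exact ⟨fun ⟨⟨h12, _⟩, ho⟩ => ⟨h12, ho⟩, fun ⟨h12, ho⟩ => ⟨⟨h12, ((h₂ ω h12).1 ho).2⟩, ho⟩⟩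
  -- the derived ones, by associativity
  have d3 : PDEvent ends a₁ a₂ a₃ ∩ (connEvent ends a₁ o ∩ connEvent ends a₁ b) = ∅ := by
    rw [← Set.inter_assoc, d1, Set.empty_inter]
  have d4 : PDEvent ends a₁ a₂ a₃ ∩ (connEvent ends a₂ o ∩ connEvent ends a₁ b) = ∅ := by
    rw [← Set.inter_assoc, d2, Set.empty_inter]
  have d5 : PDEvent ends a₁ a₂ a₃ ∩ (connEvent ends a₁ o ∩ connEvent ends a₂ b) = ∅ := by
    rw [← Set.inter_assoc, d1, Set.empty_inter]
  have d6 : PDEvent ends a₁ a₂ a₃ ∩ (connEvent ends a₂ o ∩ connEvent ends a₂ b) = ∅ := by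
    rw [← Set.inter_assoc, d2, Set.empty_inter]
  have u1 : TEvent ends a₂ a₁ a₃ ∩ (connEvent ends a₁ o ∩ connEvent ends a₁ b) =
      avoidAll ends a₂ {a₁} ∩ (connEvent ends a₁ o ∩ connEvent ends a₁ b) := by
    rw [← Set.inter_assoc, t1, Set.inter_assoc]
  have u2 : TEvent ends a₂ a₁ a₃ ∩ (connEvent ends a₂ o ∩ connEvent ends a₁ b) = ∅ := by
    rw [← Set.inter_assoc, t2, Set.empty_inter]
  have u3 : TEvent ends a₁ a₂ a₃ ∩ (connEvent ends a₁ o ∩ connEvent ends a₂ b) = ∅ := by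
    rw [← Set.inter_assoc, t3, Set.empty_inter]
  have u4 : TEvent ends a₁ a₂ a₃ ∩ (connEvent ends a₂ o ∩ connEvent ends a₂ b) =
      avoidAll ends a₂ {a₁} ∩ (connEvent ends a₂ o ∩ connEvent ends a₂ b) := by
    rw [← Set.inter_assoc, t4, Set.inter_assoc]
  have u5 : TEvent ends a₁ a₂ a₃ ∩ (connEvent ends a₁ o ∩ connEvent ends a₁ b) = ∅ := by
    rw [← Set.inter_assoc, t3, Set.empty_inter]
  have u6 : TEvent ends a₁ a₂ a₃ ∩ (connEvent ends a₂ o ∩ connEvent ends a₁ b) =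
      avoidAll ends a₂ {a₁} ∩ (connEvent ends a₂ o ∩ connEvent ends a₁ b) := by
    rw [← Set.inter_assoc, t4, Set.inter_assoc]
  have u7 : TEvent ends a₂ a₁ a₃ ∩ (connEvent ends a₁ o ∩ connEvent ends a₂ b) =
      avoidAll ends a₂ {a₁} ∩ (connEvent ends a₁ o ∩ connEvent ends a₂ b) := by
    rw [← Set.inter_assoc, t1, Set.inter_assoc]
  have u8 : TEvent ends a₂ a₁ a₃ ∩ (connEvent ends a₂ o ∩ connEvent ends a₂ b) = ∅ := by
    rw [← Set.inter_assoc, t2, Set.empty_inter]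
  -- the four mass identities
  have hDo : Do p ends o a₁ a₂ a₃ = 0 := by
    unfold Do
    rw [d1, d2, prob_empty, add_zero]
  have hPDbo : PDbo p ends o a₁ a₂ a₃ b = 0 := by
    unfold PDbo
    rw [d3, d4, d5, d6, prob_empty]
    ring
  have hEQ3o : EQ3o p ends o a₁ a₂ a₃ = EQo p ends o a₁ a₂ := by
    unfold EQ3o EQo
    rw [t1, t2, t3, t4, prob_empty]
    ring
  have hEQb3o : EQb3o p ends o a₁ a₂ a₃ b = EQbo p ends o a₁ a₂ b := by
    unfold EQb3o EQbo
    rw [u1, u2, u3, u4, u5, u6, u7, u8, prob_empty]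
    ring
  unfold Gc DEF
  rw [hDo, hPDbo, hEQ3o, hEQb3o]
  ring

omit [DecidableEq V] in
/-- (HCOV) holds (with equality) on the (A3-O) class. -/
theorem hcov_of_a3_sep (p : E → R) (ends : E → Sym2 V) (o a₁ a₂ a₃ b : V)
    (h₁ : ∀ ω : Config E, ¬ Conn ends ω a₁ a₂ →
      (Conn ends ω a₁ o ↔ Conn ends ω o a₃ ∧ Conn ends ω a₁ a₃))
    (h₂ : ∀ ω : Config E, ¬ Conn ends ω a₁ a₂ →
      (Conn ends ω a₂ o ↔ Conn ends ω o a₃ ∧ Conn ends ω a₂ a₃)) :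
    HCov p ends o a₁ a₂ a₃ b := by
  unfold HCov
  rw [Gc_eq_zero_of_a3_sep p ends o a₁ a₂ a₃ b h₁ h₂]

end A3O

section OneRoot

variable {V : Type*} {E : Type*} [Fintype E] [DecidableEq E] [DecidableEq V]
  {R : Type*} [Field R] [LinearOrder R] [IsStrictOrderedRing R]

/-- **(ONE-ROOT)**, LEAD-SEP3 §2: if on `Q` the cluster of `a₁` contains none of `o`, `b`, `a₃`,
then `Gc = 0`. -/
theorem Gc_eq_zero_of_root_sep (p : E → R) (ends : E → Sym2 V) (o a₁ a₂ a₃ b : V)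
    (h : ∀ ω : Config E, ¬ Conn ends ω a₁ a₂ →
      ¬ Conn ends ω a₁ o ∧ ¬ Conn ends ω a₁ b ∧ ¬ Conn ends ω a₁ a₃) :
    Gc p ends o a₁ a₂ a₃ b = 0 := by
  -- every event inside `Q` with a connection from `a₁` to `o`, `b` or `a₃` is empty
  obtain ⟨eT', eQo, eQb, eQ1, eQ2, eQ3, eTb, eTo, eT1, eT2, eT3, ePDb, ePDo, ePD1, ePD2, ePD3⟩ :
      TEvent ends a₂ a₁ a₃ = ∅ ∧
      avoidAll ends a₂ {a₁} ∩ connEvent ends a₁ o = ∅ ∧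
      avoidAll ends a₂ {a₁} ∩ connEvent ends a₁ b = ∅ ∧
      avoidAll ends a₂ {a₁} ∩ (connEvent ends a₁ o ∩ connEvent ends a₁ b) = ∅ ∧
      avoidAll ends a₂ {a₁} ∩ (connEvent ends a₂ o ∩ connEvent ends a₁ b) = ∅ ∧
      avoidAll ends a₂ {a₁} ∩ (connEvent ends a₁ o ∩ connEvent ends a₂ b) = ∅ ∧
      TEvent ends a₁ a₂ a₃ ∩ connEvent ends a₁ b = ∅ ∧
      TEvent ends a₁ a₂ a₃ ∩ connEvent ends a₁ o = ∅ ∧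
      TEvent ends a₁ a₂ a₃ ∩ (connEvent ends a₁ o ∩ connEvent ends a₂ b) = ∅ ∧
      TEvent ends a₁ a₂ a₃ ∩ (connEvent ends a₁ o ∩ connEvent ends a₁ b) = ∅ ∧
      TEvent ends a₁ a₂ a₃ ∩ (connEvent ends a₂ o ∩ connEvent ends a₁ b) = ∅ ∧
      PDEvent ends a₁ a₂ a₃ ∩ connEvent ends a₁ b = ∅ ∧
      PDEvent ends a₁ a₂ a₃ ∩ connEvent ends a₁ o = ∅ ∧
      PDEvent ends a₁ a₂ a₃ ∩ (connEvent ends a₁ o ∩ connEvent ends a₁ b) = ∅ ∧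
      PDEvent ends a₁ a₂ a₃ ∩ (connEvent ends a₂ o ∩ connEvent ends a₁ b) = ∅ ∧
      PDEvent ends a₁ a₂ a₃ ∩ (connEvent ends a₁ o ∩ connEvent ends a₂ b) = ∅ := by
    refine ⟨?_, ?_, ?_, ?_, ?_, ?_, ?_, ?_, ?_, ?_, ?_, ?_, ?_, ?_, ?_, ?_⟩ <;> ext ω <;>
      have g := h ω <;>
      have g₀ : Conn ends ω a₂ a₁ ↔ Conn ends ω a₁ a₂ := ⟨conn_symm, conn_symm⟩ <;>
      simp only [Set.mem_inter_iff, mem_PD, mem_T, mem_Q, connEvent, Set.mem_setOf_eq,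
        Set.mem_empty_iff_false] <;> tauto
  -- the masses
  have hEQbo : EQbo p ends o a₁ a₂ b =
      prob p (avoidAll ends a₂ {a₁} ∩ (connEvent ends a₂ o ∩ connEvent ends a₂ b)) := by
    unfold EQbo
    rw [eQ1, eQ2, eQ3, prob_empty]
    ring
  have hEQb3 : EQb3 p ends a₁ a₂ a₃ b = prob p (TEvent ends a₁ a₂ a₃ ∩ connEvent ends a₂ b) := by
    unfold EQb3
    rw [eT', eTb]
    simp only [Set.empty_inter, prob_empty]
    ring
  have hEQb3o : EQb3o p ends o a₁ a₂ a₃ b =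
      prob p (TEvent ends a₁ a₂ a₃ ∩ (connEvent ends a₂ o ∩ connEvent ends a₂ b)) := by
    unfold EQb3o
    rw [eT', eT1, eT2, eT3]
    simp only [Set.empty_inter, prob_empty]
    ring
  have hEQo : EQo p ends o a₁ a₂ = - prob p (avoidAll ends a₂ {a₁} ∩ connEvent ends a₂ o) := by
    unfold EQo
    rw [eQo, prob_empty]
    ring
  have hEQ3 : EQ3 p ends a₁ a₂ a₃ = - prob p (TEvent ends a₁ a₂ a₃) := by
    unfold EQ3
    rw [eT', prob_empty]
    ring
  have hEQ3o : EQ3o p ends o a₁ a₂ a₃ = - prob p (TEvent ends a₁ a₂ a₃ ∩ connEvent ends a₂ o) := by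
    unfold EQ3o
    rw [eT', eTo]
    simp only [Set.empty_inter, prob_empty]
    ring
  have hPDb : PDb p ends a₁ a₂ a₃ b = prob p (PDEvent ends a₁ a₂ a₃ ∩ connEvent ends a₂ b) := by
    unfold PDb
    rw [ePDb, prob_empty, zero_add]
  have hPDbo : PDbo p ends o a₁ a₂ a₃ b =
      prob p (PDEvent ends a₁ a₂ a₃ ∩ (connEvent ends a₂ o ∩ connEvent ends a₂ b)) := by
    unfold PDbo
    rw [ePD1, ePD2, ePD3, prob_empty]
    ring
  have hDo : Do p ends o a₁ a₂ a₃ = prob p (PDEvent ends a₁ a₂ a₃ ∩ connEvent ends a₂ o) := by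
    unfold Do
    rw [ePDo, prob_empty, zero_add]
  have hgap : gap p ends a₁ a₂ b = prob p (avoidAll ends a₂ {a₁} ∩ connEvent ends a₂ b) := by
    rw [gap_eq_Q, eQb, prob_empty, sub_zero]
  -- `Q = PD ⊔ T` on the `a₂`-events (`T′ = ∅`)
  have s0 := Qsplit_univ p ends a₁ a₂ a₃
  have so := Qsplit p ends a₁ a₂ a₃ (connEvent ends a₂ o)
  have sb := Qsplit p ends a₁ a₂ a₃ (connEvent ends a₂ b)
  have sbo := Qsplit p ends a₁ a₂ a₃ (connEvent ends a₂ o ∩ connEvent ends a₂ b)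
  rw [eT', prob_empty, add_zero] at s0
  rw [eT', Set.empty_inter, prob_empty, add_zero] at so sb sbo
  unfold Gc DEF
  rw [hEQbo, hEQb3, hEQb3o, hEQo, hEQ3, hEQ3o, hPDb, hPDbo, hDo, hgap, s0, so, sb, sbo]
  ring

/-- (HCOV) holds (with equality) on the (ONE-ROOT) class. -/
theorem hcov_of_root_sep (p : E → R) (ends : E → Sym2 V) (o a₁ a₂ a₃ b : V)
    (h : ∀ ω : Config E, ¬ Conn ends ω a₁ a₂ →
      ¬ Conn ends ω a₁ o ∧ ¬ Conn ends ω a₁ b ∧ ¬ Conn ends ω a₁ a₃) :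
    HCov p ends o a₁ a₂ a₃ b := by
  unfold HCov
  rw [Gc_eq_zero_of_root_sep p ends o a₁ a₂ a₃ b h]

end OneRoot

end Summit.Ventures.PercRepro2.SepZero
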